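import Summits.QuantumAdvantage.QuantumAdvantage.Theses.CubicForrelation
import Literature.Computability.QuantumComplexity.SignedCubicForrelation
import Literature.Computability.QuantumComplexity.SignedForrelationMem
import Literature.Computability.Complexity.CircuitComposition

/-!
# `SignedExactSliceIsLift` (stmt-QuantumAdvantage-14830), negative side —
# TIGHTNESS TRANSFER for the top gap of the landed family (every near-exact cubic pair bounds `p₀`)

Negative-side (cdisprove) lemmas for crux K2 `SignedExactSliceIsLift` and its picked line
`reduce-then-lift` (stub V = value set of the LANDED signed family `PhaseQuery.family SgnForrMem.paramsS`
on well-formed cubic codes; stub A = exact `K`-fold AND-power). Stub V asserts, under `NearExactIsExact`,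
a constant `p₀ < 1` bounding the family's acceptance on every well-formed cubic code with `Φ ≠ 1`.

* `exists_wf_code_of_pair` (TRANSFER): EVERY cubic pair `(f, g)` on `m + m` bits in which `g` depends on
  every coordinate is realised by a well-formed cubic code (`B₂`-circuits from the universal bound,
  `k = 2`, even `n`, every wire read) on which the landed family accepts with probability EXACTLY
  `1 − (1 − ((1 + Φ(f,g))/2)²)³`; so (`stubV_p0_ge_of_pair`) every admissible `p₀` of stub V is
  `≥ 1 − (1 − ((1 + Φ)/2)²)³` for every such NON-exact pair: each near-exact cubic pair found on the
  r2 side (crux `NearExactIsExact`, stmt-14043: `Φ = 15/16` at `n = 16`, MM-shape ceiling `31/32`) is at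
  once a lower bound on the raw top gap of K2's line.
* `depends_of_W_ne_zero`: a function whose Walsh transform vanishes nowhere (e.g. a BENT `g`, the case of
  every exact or near-exact pair of interest) depends on every coordinate — so the transfer applies with
  no syntactic work on circuits (`n_le_sR_of_depends'`: semantic dependence ⇒ every wire is read).
* Self-contained instantiation at `n = 4` (`g = x₀x₂ ⊕ x₁x₃` bent, `f = g ⊕ x₀x₁x₂`, `Φ = 3/4`,
  Kasami–Tokura): `stubV_p0_ge_kasamiTokura` (`p₀ ≥ 1 − (15/64)³ ≈ 0.9871`) and `andPower_copies_ge_52`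
  (`p₀^K ≤ 1/3 ⇒ K ≥ 52`). The `Φ = 15/16` pair of
  `Theorems/NearExactIsExact/Negative/FifteenSixteenths.lean` upgrades this to `p₀ ≥ 1 − (63/1024)³`,
  `K ≥ 2863` by the same two lines (follow-up file; that module was not built on the farm at writing).

No definitions are introduced.
-/

noncomputable section

set_option linter.dupNamespace false -- D-0017: single-problem summit ⇒ `QuantumAdvantage.QuantumAdvantage` by design

open Finset
open Literature.Computability.Complexity Literature.Computability.Cryptography
open Literature.Computability.QuantumComplexity
open Literature.Computability.QuantumComplexity.PhaseQuery
open Literature.Computability.QuantumComplexity.ForrMem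
open Literature.Computability.QuantumComplexity.SgnForrMem
open Literature.Computability.QuantumComplexity.DerivativeWalsh (W)

namespace Summit.QuantumAdvantage.QuantumAdvantage.Theorems.SignedExactSliceIsLift.Negative

/-! ### Exact acceptance off the promise (private copies; public versions in `LandedFamilyUngapped`) -/

/-- Exact modulus of the return amplitude off the promise (private copy; public version
`norm_phiFin_of_le` in `LandedFamilyUngapped.lean`). [cite: AaronsonAmbainis2018, §3.2 Prop. 6] -/
private theorem norm_phiFin_of_le'' (I : KForrelationInstance) (hk : I.k = 2) (he : Even I.n)
    (h : I.n ≤ sR I + 1) (A : Language Bool) :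
    ‖phiFin paramsS specS I.encode A fun _ => false‖ = (1 + I.value) / 2 := by
  obtain ⟨hq, hq0⟩ := isSelfDualBent_qM (even_WdS_of_le I h)
  have e : forrelation (fun w : Fin (WdS I) → Bool => cfun I 0 w) (fun w => cfun I 1 w) = I.value := by
    rw [forrelation_cfun I hk (WdS I) (sR_le_WdS I), value_eq, hk, WdS_eq_of_le I h, if_pos he,
      Nat.add_zero]
  rw [phiFin_encode I hk, gS_vec, Complex.norm_real, Real.norm_eq_abs]
  have hg := kForrelationValue_gadget (fun w : Fin (WdS I) → Bool => cfun I 0 w) (fun w => cfun I 1 w)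
    (qW I) hq hq0
  simp only at hg
  rw [show (qW I) = fun w => qW I w from rfl] at hg
  erw [hg, abs_gadget, e]

/-- Exact acceptance off the promise (private copy; public version `acceptProbOn_of_le` in
`LandedFamilyUngapped.lean`). [cite: AaronsonAmbainis2018, §3.2 Prop. 6] -/
private theorem acceptProbOn_of_le'' (I : KForrelationInstance) (hk : I.k = 2) (he : Even I.n)
    (h : I.n ≤ sR I + 1) :
    (family paramsS).acceptProbOn 0 I.encode = 1 - (1 - ((1 + I.value) / 2) ^ 2) ^ 3 := by
  rw [acceptProbOn_family paramsS specS I.encode 0, norm_phiFin_of_le'' I hk he h]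

/-! ### Walsh non-vanishing forces dependence on every coordinate; dependence forces reads -/

/-- `(-1)^{x · e_i} = (-1)^{x_i}`. [folklore] -/
private theorem twist_indicator {n : ℕ} (x : Fin n → Bool) (i : Fin n) :
    twist x (fun l => decide (l = i)) = signOf (x i) := by
  unfold twist
  rw [Finset.prod_eq_single i]
  · cases x i <;> simp [signOf]
  · intro b _ hb; simp [hb]
  · simp

/-- **A function whose Walsh transform vanishes nowhere depends on every coordinate**: if `g` ignored
coordinate `i`, pairing `x` with `x ⊕ e_i` would kill `W_g(e_i)`. [cite: ODonnell2014, §1.4] -/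
theorem depends_of_W_ne_zero {n : ℕ} (g : (Fin n → Bool) → Bool)
    (hW : ∀ y, W (fun x => signOf (g x)) y ≠ 0) (i : Fin n) :
    ∃ x x' : Fin n → Bool, (∀ l, l ≠ i → x l = x' l) ∧ g x ≠ g x' := by
  by_contra hcon
  push Not at hcon
  apply hW (fun l => decide (l = i))
  set φ : (Fin n → Bool) → (Fin n → Bool) := fun x => Function.update x i (!x i) with hφ
  have hφφ : Function.Involutive φ := by
    intro x; funext l
    by_cases hl : l = i
    · subst hl; simp [φ]
    · simp [φ, hl]
  have hg : ∀ x, g (φ x) = g x := fun x =>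
    (hcon x (φ x) fun l hl => by simp [φ, hl]).symm
  have hterm : ∀ x, signOf (g (φ x)) * twist (φ x) (fun l => decide (l = i)) =
      -(signOf (g x) * twist x (fun l => decide (l = i))) := by
    intro x
    rw [hg, twist_indicator, twist_indicator]
    have : φ x i = !x i := by simp [φ]
    rw [this]
    cases x i <;> simp [signOf]
  have key := Equiv.sum_comp hφφ.toPerm (fun x => signOf (g x) * twist x fun l => decide (l = i))
  simp only [Function.Involutive.coe_toPerm, hterm, Finset.sum_neg_distrib] at key
  -- key : -∑ h = ∑ h
  unfold W
  linarith

/-- **If some circuit of the instance depends on every input wire, every wire is read: `n ≤ #R`.**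
(Private copy of `n_le_sR_of_depends` of `DegreeBlindUngapped.lean`, whose module was not yet built on
the farm when this file was written; to be replaced by an import.) [folklore] -/
private theorem n_le_sR_of_depends' (I : KForrelationInstance)
    (h : ∀ i : Fin I.n, ∃ t : Fin I.k, ∃ x x' : Fin I.n → Bool,
      (∀ l, l ≠ i → x l = x' l) ∧ (I.C t).eval x ≠ (I.C t).eval x') :
    I.n ≤ sR I := by
  have hread : ∀ i : Fin I.n, i.val ∈ occList I := by
    intro i
    obtain ⟨t, x, x', hxx', hne⟩ := h i
    refine mem_occList_of_mem_readsC I t ?_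
    by_contra hi
    exact hne (eval_congr_reads (I.C t) fun l hl => hxx' l fun e => hi (e ▸ hl))
  let φ : Fin I.n → Fin (sR I) := fun i => ⟨rank I i, rank_lt_of_mem I (hread i)⟩
  have hφ : Function.Injective φ := fun i i' e =>
    rank_injOn I (rank_lt_of_mem I (hread i)) (by simpa [φ] using congrArg Fin.val e)
  simpa using Fintype.card_le_of_injective φ hφ

/-! ### TRANSFER: every cubic pair is a well-formed code with the exact Hadamard-test acceptance -/

/-- **Transfer.** Every cubic pair `(f, g)` on `m + m` bits with `g` depending on every coordinate is
realised by a well-formed cubic code — `B₂`-circuits (universal bound), `k = 2`, `n = m + m` even, both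
cubic, every wire read — on which the landed signed family accepts with probability EXACTLY
`1 − (1 − ((1 + Φ(f,g))/2)²)³`. [cite: AaronsonAmbainis2018, §3.2 Prop. 6] -/
theorem exists_wf_code_of_pair {m : ℕ} (f g : (Fin (m + m) → Bool) → Bool)
    (hf : IsDegLeFun 3 f) (hg : IsDegLeFun 3 g)
    (hdepg : ∀ i, ∃ x x' : Fin (m + m) → Bool, (∀ l, l ≠ i → x l = x' l) ∧ g x ≠ g x') :
    ∃ I : KForrelationInstance, I.IsOverB2 ∧ I.k = 2 ∧ Even I.n ∧ (∀ i, IsDegLeFun 3 (I.C i).eval) ∧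
      I.n ≤ sR I + 1 ∧ I.value = forrelation f g ∧
      (family paramsS).acceptProbOn 0 I.encode = 1 - (1 - ((1 + forrelation f g) / 2) ^ 2) ^ 3 := by
  obtain ⟨Cf, hCfB, -, hCf⟩ := (cktSize_univ (ι := Fin (m + m)) fun x (_ : Unit) => f x).toCircuit
  obtain ⟨Cg, hCgB, -, hCg⟩ := (cktSize_univ (ι := Fin (m + m)) fun x (_ : Unit) => g x).toCircuit
  have hCf' : Cf.eval = f := funext fun x => hCf x
  have hCg' : Cg.eval = g := funext fun x => hCg x
  set I : KForrelationInstance := ⟨m + m, 2, ![Cf, Cg]⟩ with hI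
  have hB2 : I.IsOverB2 := by
    intro i; fin_cases i
    · exact hCfB
    · exact hCgB
  have he : Even I.n := ⟨m, rfl⟩
  have hdeg : ∀ i, IsDegLeFun 3 (I.C i).eval := by
    intro i; fin_cases i
    · show IsDegLeFun 3 Cf.eval; rw [hCf']; exact hf
    · show IsDegLeFun 3 Cg.eval; rw [hCg']; exact hg
  have hdep : ∀ i : Fin I.n, ∃ s : Fin I.k, ∃ x x' : Fin I.n → Bool,
      (∀ l, l ≠ i → x l = x' l) ∧ (I.C s).eval x ≠ (I.C s).eval x' := by
    intro i
    refine ⟨1, ?_⟩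
    show ∃ x x' : Fin (m + m) → Bool, (∀ l, l ≠ i → x l = x' l) ∧ Cg.eval x ≠ Cg.eval x'
    rw [hCg']
    exact hdepg i
  have hle : I.n ≤ sR I + 1 := Nat.le_succ_of_le (n_le_sR_of_depends' I hdep)
  have hval : I.value = forrelation f g := by
    rw [hI, KForrelationInstance.value_mk_two]
    simp only [Matrix.cons_val_zero, Matrix.cons_val_one]
    rw [hCf', hCg']
  refine ⟨I, hB2, rfl, he, hdeg, hle, hval, ?_⟩
  rw [acceptProbOn_of_le'' I rfl he hle, hval]

/-- **Tightness transfer for stub V's constant.** If `p₀` bounds the landed family's acceptance on all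
well-formed cubic codes with `Φ ≠ 1`, then for EVERY non-exact cubic pair `(f, g)` on `m + m` bits with `g`
depending on every coordinate, `p₀ ≥ 1 − (1 − ((1 + Φ(f,g))/2)²)³`. [cite: AaronsonAmbainis2018, §3.2 Prop. 6] -/
theorem stubV_p0_ge_of_pair (p₀ : ℝ)
    (h : ∀ I : KForrelationInstance, I.IsOverB2 → I.k = 2 → Even I.n → (∀ i, IsDegLeFun 3 (I.C i).eval) →
      I.n ≤ sR I + 1 → I.value ≠ 1 → (family paramsS).acceptProbOn 0 I.encode ≤ p₀)
    {m : ℕ} (f g : (Fin (m + m) → Bool) → Bool) (hf : IsDegLeFun 3 f) (hg : IsDegLeFun 3 g)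
    (hdepg : ∀ i, ∃ x x' : Fin (m + m) → Bool, (∀ l, l ≠ i → x l = x' l) ∧ g x ≠ g x')
    (hne : forrelation f g ≠ 1) :
    1 - (1 - ((1 + forrelation f g) / 2) ^ 2) ^ 3 ≤ p₀ := by
  obtain ⟨I, h1, h2, h3, h4, h5, h6, hacc⟩ := exists_wf_code_of_pair f g hf hg hdepg
  have := h I h1 h2 h3 h4 h5 (by rwa [h6])
  rwa [hacc] at this

/-- Same with `g` BENT-like (Walsh transform nowhere zero) instead of the dependence hypothesis.
[cite: ODonnell2014, §1.4] -/
theorem stubV_p0_ge_of_pair_W (p₀ : ℝ)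
    (h : ∀ I : KForrelationInstance, I.IsOverB2 → I.k = 2 → Even I.n → (∀ i, IsDegLeFun 3 (I.C i).eval) →
      I.n ≤ sR I + 1 → I.value ≠ 1 → (family paramsS).acceptProbOn 0 I.encode ≤ p₀)
    {m : ℕ} (f g : (Fin (m + m) → Bool) → Bool) (hf : IsDegLeFun 3 f) (hg : IsDegLeFun 3 g)
    (hW : ∀ y, W (fun x => signOf (g x)) y ≠ 0) (hne : forrelation f g ≠ 1) :
    1 - (1 - ((1 + forrelation f g) / 2) ^ 2) ^ 3 ≤ p₀ :=
  stubV_p0_ge_of_pair p₀ h f g hf hg (depends_of_W_ne_zero g hW) hne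

/-! ### Self-contained instantiation at `n = 4`: the Kasami–Tokura pair `Φ = 3/4` -/

/-- `g = x₀x₂ ⊕ x₁x₃` (= `ipHalf 2`) is cubic (indeed quadratic). [cite: Carlet2020, §2.2.1 Def. 6] -/
theorem isDegLeFun_ipHalf_two : IsDegLeFun 3 (ipHalf 2) := by
  refine ⟨MvPolynomial.X 0 * MvPolynomial.X 2 + MvPolynomial.X 1 * MvPolynomial.X 3, ?_, fun x => ?_⟩
  · refine (MvPolynomial.totalDegree_add _ _).trans (max_le ?_ ?_) <;>
      refine (MvPolynomial.totalDegree_mul _ _).trans ?_ <;>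
      exact (add_le_add (MvPolynomial.totalDegree_X (R := ZMod 2) _).le
        (MvPolynomial.totalDegree_X (R := ZMod 2) _).le).trans (by norm_num)
  · simp only [polyPhase, map_mul, map_add, MvPolynomial.eval_X]
    have e : ipHalf 2 x = xor (x 0 && x 2) (x 1 && x 3) := by
      revert x; decide
    rw [e]
    cases x 0 <;> cases x 1 <;> cases x 2 <;> cases x 3 <;> decide

/-- `f = g ⊕ x₀x₁x₂` is cubic. [cite: Carlet2020, §2.2.1 Def. 6] -/
theorem isDegLeFun_ipHalf_two_pert :
    IsDegLeFun 3 (fun x : Fin (2 + 2) → Bool => xor (ipHalf 2 x) (x 0 && x 1 && x 2)) := by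
  refine ⟨MvPolynomial.X 0 * MvPolynomial.X 2 + MvPolynomial.X 1 * MvPolynomial.X 3 +
    MvPolynomial.X 0 * MvPolynomial.X 1 * MvPolynomial.X 2, ?_, fun x => ?_⟩
  · refine (MvPolynomial.totalDegree_add _ _).trans (max_le ?_ ?_)
    · refine (MvPolynomial.totalDegree_add _ _).trans (max_le ?_ ?_) <;>
        refine (MvPolynomial.totalDegree_mul _ _).trans ?_ <;>
        exact (add_le_add (MvPolynomial.totalDegree_X (R := ZMod 2) _).le
          (MvPolynomial.totalDegree_X (R := ZMod 2) _).le).trans (by norm_num)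
    · refine (MvPolynomial.totalDegree_mul _ _).trans ?_
      refine (add_le_add ((MvPolynomial.totalDegree_mul _ _).trans (add_le_add
        (MvPolynomial.totalDegree_X (R := ZMod 2) _).le (MvPolynomial.totalDegree_X (R := ZMod 2) _).le))
        (MvPolynomial.totalDegree_X (R := ZMod 2) _).le).trans ?_
      norm_num
  · simp only [polyPhase, map_mul, map_add, MvPolynomial.eval_X]
    have e : ipHalf 2 x = xor (x 0 && x 2) (x 1 && x 3) := by
      revert x; decide
    rw [e]
    cases x 0 <;> cases x 1 <;> cases x 2 <;> cases x 3 <;> decide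

/-- `∑_y (-1)^{y₀y₁y₂} = 12` on `4` bits. [folklore] -/
private theorem sum_signOf_cubicMonomial :
    ∑ y : Fin (2 + 2) → Bool, signOf (y 0 && y 1 && y 2) = 12 := by
  have e : ∀ y : Fin (2 + 2) → Bool, signOf (y 0 && y 1 && y 2) =
      1 - 2 * (if (y 0 && y 1 && y 2) = true then (1 : ℝ) else 0) := by
    intro y; cases (y 0 && y 1 && y 2) <;> simp [signOf]; norm_num
  have hc : (Finset.univ.filter fun y : Fin (2 + 2) → Bool => (y 0 && y 1 && y 2) = true).card = 2 := by
    decide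
  rw [Finset.sum_congr rfl fun y _ => e y, Finset.sum_sub_distrib, Finset.sum_const, ← Finset.mul_sum,
    ← Finset.sum_filter, Finset.sum_const, hc]
  simp [Fintype.card_bool, Fintype.card_fin]
  norm_num

/-- **Kasami–Tokura pair**: `Φ(x₀x₂ ⊕ x₁x₃ ⊕ x₀x₁x₂, x₀x₂ ⊕ x₁x₃) = 3/4` (bent absorption:
`Φ = 2⁻⁴ ∑_y (-1)^{y₀y₁y₂} = 12/16`). [cite: KasamiTokura1970, Thm. 1] -/
theorem forrelation_kasamiTokura :
    forrelation (ipHalf 2) (fun x : Fin (2 + 2) → Bool => xor (ipHalf 2 x) (x 0 && x 1 && x 2)) = 3 / 4 := by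
  rw [forrelation_eq_sum_W]
  have hq := isSelfDualBent_ipHalf 2
  have e : ∀ y : Fin (2 + 2) → Bool, signOf (xor (ipHalf 2 y) (y 0 && y 1 && y 2)) *
      W (fun x => signOf (ipHalf 2 x)) y = Real.sqrt (2 ^ (2 + 2)) * signOf (y 0 && y 1 && y 2) := by
    intro y
    rw [hq y, signOf_xor]
    have hs : signOf (ipHalf 2 y) * signOf (ipHalf 2 y) = 1 := by
      cases ipHalf 2 y <;> simp [signOf]
    calc signOf (ipHalf 2 y) * signOf (y 0 && y 1 && y 2) * (Real.sqrt (2 ^ (2 + 2)) * signOf (ipHalf 2 y))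
        = (signOf (ipHalf 2 y) * signOf (ipHalf 2 y)) * (Real.sqrt (2 ^ (2 + 2)) * signOf (y 0 && y 1 && y 2)) := by ring
      _ = _ := by rw [hs, one_mul]
  rw [Finset.sum_congr rfl fun y _ => e y, ← Finset.mul_sum, sum_signOf_cubicMonomial, sqrt_two_pow_add_self,
    show 3 * (2 + 2) = 6 + 6 by norm_num, sqrt_two_pow_add_self]
  norm_num

/-- By symmetry of `Φ` the same pair in the order (cubic `f`, bent `g`). [cite: AaronsonAmbainis2018, §1.1.1] -/
theorem forrelation_kasamiTokura' :
    forrelation (fun x : Fin (2 + 2) → Bool => xor (ipHalf 2 x) (x 0 && x 1 && x 2)) (ipHalf 2) = 3 / 4 := by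
  rw [← forrelation_kasamiTokura]
  unfold forrelation
  congr 1
  rw [Finset.sum_comm]
  refine Finset.sum_congr rfl fun x _ => Finset.sum_congr rfl fun y _ => ?_
  rw [twist_comm]; ring

/-- The Walsh transform of the bent `ipHalf 2` vanishes nowhere. [cite: ODonnell2014, §1.4] -/
theorem W_ipHalf_ne_zero (t : ℕ) (y : Fin (t + t) → Bool) : W (fun x => signOf (ipHalf t x)) y ≠ 0 := by
  rw [isSelfDualBent_ipHalf t y]
  have h1 : Real.sqrt (2 ^ (t + t)) ≠ 0 := by positivity
  have h2 : signOf (ipHalf t y) ≠ 0 := by cases ipHalf t y <;> simp [signOf]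
  exact mul_ne_zero h1 h2

/-- **Stub V's constant for the landed family is `≥ 1 − (15/64)³ ≈ 0.9871`** (from the `Φ = 3/4`
Kasami–Tokura pair at `n = 4`; the `Φ = 15/16` pair of `FifteenSixteenths.lean` gives `≥ 1 − (63/1024)³`
by the same line). [cite: KasamiTokura1970, Thm. 1] -/
theorem stubV_p0_ge_kasamiTokura (p₀ : ℝ)
    (h : ∀ I : KForrelationInstance, I.IsOverB2 → I.k = 2 → Even I.n → (∀ i, IsDegLeFun 3 (I.C i).eval) →
      I.n ≤ sR I + 1 → I.value ≠ 1 → (family paramsS).acceptProbOn 0 I.encode ≤ p₀) :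
    1 - ((15 : ℝ) / 64) ^ 3 ≤ p₀ := by
  have := stubV_p0_ge_of_pair_W p₀ h _ _ isDegLeFun_ipHalf_two_pert isDegLeFun_ipHalf_two
    (W_ipHalf_ne_zero 2) (by rw [forrelation_kasamiTokura']; norm_num)
  rw [forrelation_kasamiTokura'] at this
  norm_num at this ⊢
  linarith

/-- **Hence the AND-power uses `K ≥ 52` copies of the landed family** (`p₀^K ≤ 1/3`, Bernoulli; with
the `15/16` pair: `K ≥ 2863`). [cite: AaronsonAmbainis2018, §3.2 Prop. 6] -/
theorem andPower_copies_ge_52 (p₀ : ℝ) (K : ℕ)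
    (h : ∀ I : KForrelationInstance, I.IsOverB2 → I.k = 2 → Even I.n → (∀ i, IsDegLeFun 3 (I.C i).eval) →
      I.n ≤ sR I + 1 → I.value ≠ 1 → (family paramsS).acceptProbOn 0 I.encode ≤ p₀)
    (hK : p₀ ^ K ≤ 1 / 3) : 52 ≤ K := by
  have hp : (258769 : ℝ) / 262144 ≤ p₀ := by
    have := stubV_p0_ge_kasamiTokura p₀ h; norm_num at this; linarith
  have hpow : ((258769 : ℝ) / 262144) ^ K ≤ p₀ ^ K := pow_le_pow_left₀ (by norm_num) hp K
  have hbern : 1 + (K : ℝ) * (-(3375 : ℝ) / 262144) ≤ (1 + -(3375 : ℝ) / 262144) ^ K :=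
    one_add_mul_le_pow (by norm_num) K
  rw [show (1 : ℝ) + -(3375 : ℝ) / 262144 = 258769 / 262144 by norm_num] at hbern
  by_contra hlt
  push Not at hlt
  have hK' : (K : ℝ) ≤ 51 := by exact_mod_cast Nat.lt_succ_iff.1 hlt
  have h3 : (1 : ℝ) / 3 < (258769 / 262144 : ℝ) ^ K := by linarith
  linarith

end Summit.QuantumAdvantage.QuantumAdvantage.Theorems.SignedExactSliceIsLift.Negative

end
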